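import Summits.AtomisticToContinuum.FouriersLaw.Theses.VanishingNoiseTransfer
import Summits.AtomisticToContinuum.FouriersLaw.Theses.FeketeSeriesLaw
import Summits.AtomisticToContinuum.FouriersLaw.Theses.JunctionLocality
import Literature.MathematicalPhysics.KineticTheory.VelocityFlipNoise

/-!
# Line `fekete-transposed-uniformity` for crux `VanishingNoiseTransfer.NoiseLocality`
(stmt-AtomisticToContinuum-11975, route `route-AtomisticToContinuum-VanishingNoiseTransfer`, rank 2)

Crux (X1, read back from `Theses/VanishingNoiseTransfer.lean`): for `pinnedChain ω₂ lam β γ` (all `> 0`)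
with the flip-noisy weak steady-state predicate `S` (`= IsFlipSteadyState` by `rfl`,
`isFlipSteadyState_fun_eq`) and every `T > 0` there is ONE modulus `w`, `w → 0` at `0⁺`, such that for
EVERY `N`, every `ε ∈ (0,1]`, the unique deterministic / rate-`ε` steady families at this `N` and their
response coefficients `D0, Dε` at `T`: `|D0 − Dε| ≤ w(ε)·|D0|·|Dε|` (division-free
`|1/D_N(ε) − 1/D_N(0)| ≤ w(ε)`, `w` UNIFORM IN `N`).

THE LINE (idea card `Ideas/fekete-transposed-uniformity.md`, triage r1: pass / pass / pass, sharpened as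
the panel asked).  Do not differentiate in the noise.  Along the unique flip-steady families let
`R_N(ε) := (N−1)/D_N(ε)` (bath-to-bath resistance).  If the TWO-SIDED SERIES LAW
`|R_{N+M}(ε) − R_N(ε) − R_M(ε)| ≤ C` holds with ONE junction constant for all `ε ∈ [0,1]`, `N, M ≥ 2`,
then Fekete-with-rate gives `|R_N(ε) − Nℓ(ε)| ≤ C`, so `r_N := 1/D_N → ℓ` UNIFORMLY on `[0,1]`; with
fixed-`N` continuity of `ε ↦ D_N(ε)` the limit `ℓ` is continuous and the family `(r_N)_N` is
equicontinuous at `0`, which is X1 with `w(ε) := sup_N |r_N(ε) − r_N(0)|`.  Stubs (6):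

* `stub_flipSteadyStateWellPosed` (L, fixed `N`) — for every `N`, every rate `ε ∈ [0,1]` and
  `T_L, T_R > 0` the weak steady state of `L + εS` exists and is unique.  At `ε > 0` this is clause (i)
  of the route's X3 `NoisyFourier`; at `ε = 0` it is the landed `pinnedChain_exists_isSteadyState` plus
  the shared support `NessUnique` (stmt-0741) — `wellPosed_of_noisyFourier_nessUnique` below (proved).
* `stub_responseContinuousInNoise` (L, fixed `N`; LOAD-BEARING by triage r1-2's mutation test) — for
  every `N` and `T > 0` there is `D : ℝ → ℝ`, CONTINUOUS ON `[0,1]`, which is the linear-response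
  coefficient of every unique flip-steady family at each rate `ε ∈ [0,1]` (existence = the noisy
  analogue of stmt-0717 `FiniteResponseOfUnique`; continuity in the bounded-jump-perturbation parameter
  `ε` = Hairer–Majda 2009 Thm 2.3-type regularity of NESS expectations, unverified hypotheses).
* `stub_positiveNoisyConductance` (M, fixed `N`) — `D_N(ε) > 0` for `N ≥ 2`, `ε ∈ [0,1]` (the noisy
  analogue of stmt-11750 `PositiveConductance`; finite-volume Kubo variance non-degenerate).
* `stub_seriesLawAtZero` (XL, SHARED — not new load) — the two-sided series law at `ε = 0`, stated in the
  siblings' own shape; `seriesLawAtZero_of_siblings` (proved) derives it from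
  `FeketeSeriesLaw.QuasiSubadditiveResistance` (stmt-14041) ∧ `JunctionLocality.SuperadditiveResistance`
  (stmt-11748), so staffing merges with those two rank-2 cruxes (triage r1-1/r1-2 sharpen).
* `stub_uniformSeriesLawPositiveNoise` (XL, HARDEST — the line's only NEW load, "U" of triage r1-2) —
  `∃ C = C(T)` such that for EVERY `ε ∈ (0,1]`, along the unique rate-`ε` flip-steady family with
  positive responses, `|R_{N+M} − R_N − R_M| ≤ C` for all `N, M ≥ 2`: the junction (reservoir-insertion)
  cost is bounded uniformly in the noise down to `ε = 0⁺`.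
* `stub_equicontinuityOfSeriesLaw` (M, pure real analysis, provable now) — the card's First lemma
  (two-sided Fekete on `{N ≥ 2}` with rate + uniform limit of continuous functions + finite/cofinite split).

COMPOSITION `NoiseLocality_of` (sorry-free): canonical family by choice from stub 1; responses `Dc N : ℝ → ℝ`
from stub 2; positivity from stub 3; `C₀` from stub 4 (at `ε = 0`, via `isFlipSteadyState_zero_iff`), `C₁`
from stub 5; stub 6 at `r N ε := (Dc N ε)⁻¹`, `C := max C₀ C₁` gives `w`; then for the crux's own
`μ0, με, D0, Dε`: `N ≤ 1` is trivial (`totalCurrent ≡ 0`, Disproof §1), and for `N ≥ 2` uniqueness of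
limits along `𝓝[≠] 0` identifies `D0 = Dc N 0`, `Dε = Dc N ε`, whence the WEIGHTED form
`|D0 − Dε| = |D0||Dε|·|Dε⁻¹ − D0⁻¹| ≤ w(ε)|D0||Dε|` (Disproof §4 `additive_form_fails_ballistic`: the
weights are kept, never the additive form).

Disproof used.  The standing `Disproof.lean` (cdisprove-11975-0, v3 20260815T223413Z) lives in the gate
evidence store, which is NOT mounted in this seat (`ledger crux cat … Disproof.lean` → no crux workfile; same
for all three triagers); it is used through its evidence notes v1–v3.  No `_false_without_<H>` theorem is
recorded (§6: the crux RESISTS — no kernel counterexample, uniqueness hypotheses unwitnessable for `N ≥ 2`).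
Honoured: §1 (`conclusion_of_le_one`) — the `N ≤ 1` branch of `NoiseLocality_of` is proved, not stubbed;
§4 `pointwise_modulus_insufficient` (N-uniformity cannot be dropped) — stubs 4/5 put `∃ C` BEFORE
`∀ ε, N, M` and stub 6 outputs ONE `w` for all `N ≥ 2`; §4 `localityShape_ballistic` — consistent: the
series law holds in the ballistic harmonic corner (`R_N(0)` bounded, `ℓ(0) = 0` allowed; no finiteness of
`κ₀` is used or produced — that stays with X2); §4 `additive_form_fails_ballistic` — weighted form proved;
§5b `localityShape_of_parts` (road map: fixed-`N` continuity + continuity of `1/κ_ε` at `0⁺` + convergence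
uniform in `ε` ⇒ shape) — this line IS that road map with the last two inputs DERIVED from the two-sided law
(stub 6), the first being stub 2.  Landed `Theorems/NoiseLocality/Negative/`: none (checked); nothing to import.
-/

noncomputable section

namespace Summit.AtomisticToContinuum.FouriersLaw.Cruxes.NoiseLocality.FeketeTransposedUniformity

open Filter Topology MeasureTheory
open Literature.MathematicalPhysics.KineticTheory.HeatConduction

/-! ## Registered stubs

Shape (D-0027 §3.3, as in `Cruxes/SuperadditiveResistance/Lines/balanced-split-concavity-transfer.lean`):
each stub is a sorried theorem `Holds.stub_<name> : <full statement> := by sorry` — `ledger skeleton check`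
registers it under `stub_<name>` with THAT text as signature — plus the by-name handle
`def stub_<name> : Prop := type_of% Holds.stub_<name>` used as hypothesis of `NoiseLocality_of`
(the skeleton audit admits hypotheses by the last name component; seats cannot apply `@[stub]`).
All statements are over tree declarations only (`pinnedChain`, `IsFlipSteadyState`, `IsSteadyState`,
`totalCurrent`), fully qualified, so that a prover's `propose --supports stmt-AtomisticToContinuum-11975`
can restate them verbatim. -/

/-- **Stub 1 — `stub_flipSteadyStateWellPosed` (fixed-`N` well-posedness on the closed noise interval;
size L; shared content).**  For `pinnedChain ω₂ lam β γ` (all `> 0`), every `N`, every flip rate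
`ε ∈ [0,1]` and all `T_L, T_R > 0` the weak steady state of `L + εS` (`IsFlipSteadyState`: probability,
`∫ (L + εS) f dμ = 0` for `f ∈ C_c^∞`, bond currents integrable) EXISTS and is UNIQUE.  `ε > 0`: clause (i)
of X3 `NoisyFourier` (Bernardin–Olla 2011 Prop 1 for the unpinned chain; pinned: Cuneo–Eckmann–Hairer–
Rey-Bellet 2018 Harris/Lyapunov machinery + bounded jump perturbation + Echeverría identification of weak
stationary solutions); `ε = 0`: landed `pinnedChain_exists_isSteadyState` + `NessUnique` (stmt-0741).
See `wellPosed_of_noisyFourier_nessUnique`.  Needed because the line compares `R_N(ε')` at ALL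
`ε' ∈ [0,1]`, not only at the crux's `ε` and `0`. -/
theorem Holds.stub_flipSteadyStateWellPosed :
    ∀ ω₂ lam β γ : ℝ, 0 < ω₂ → 0 < lam → 0 < β → 0 < γ →
    ∀ (N : ℕ) (ε : ℝ), 0 ≤ ε → ε ≤ 1 → ∀ T_L T_R : ℝ, 0 < T_L → 0 < T_R →
      ∃ μ : MeasureTheory.Measure (Literature.MathematicalPhysics.KineticTheory.HeatConduction.PhaseSpace N),
        (Literature.MathematicalPhysics.KineticTheory.HeatConduction.pinnedChain ω₂ lam β γ).IsFlipSteadyState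
            N T_L T_R ε μ ∧
          ∀ ν : MeasureTheory.Measure (Literature.MathematicalPhysics.KineticTheory.HeatConduction.PhaseSpace N),
            (Literature.MathematicalPhysics.KineticTheory.HeatConduction.pinnedChain ω₂ lam β γ).IsFlipSteadyState
              N T_L T_R ε ν → ν = μ := by
  sorry

/-- **Stub 2 — `stub_responseContinuousInNoise` (fixed-`N` linear response, continuous in the noise on
`[0,1]`; size L; LOAD-BEARING).**  For all parameters `> 0`, every `N` and `T > 0` there is `D : ℝ → ℝ`,
`ContinuousOn D (Set.Icc 0 1)`, such that for every `ε ∈ [0,1]` and every UNIQUE flip-steady family `μ` at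
rate `ε` (length `N`), `totalCurrent(μ(T+δ/2, T−δ/2))/δ → D ε` as `δ → 0`, `δ ≠ 0`.  Existence of the
limit is the noisy twin of stmt-0717 `FiniteResponseOfUnique` (Rey-Bellet 2003 Rem 4.4 finite-volume
Green–Kubo); continuity in `ε` is regularity of NESS expectations in the coefficient of a bounded jump
perturbation of the hypoelliptic Langevin generator (Hairer–Majda 2009, arXiv:0909.4313 Thm 2.3 framework —
its Assumptions 1–3 are unverified for this chain; nothing `N`-uniform is asked).  Triage r1-2: dropping
continuity AT `ε = 0` kills the line (`r_N(ε) = c` for `ε > 0`, `c + 1` at `0` obeys every series law). -/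
theorem Holds.stub_responseContinuousInNoise :
    ∀ ω₂ lam β γ : ℝ, 0 < ω₂ → 0 < lam → 0 < β → 0 < γ →
    ∀ (N : ℕ) (T : ℝ), 0 < T →
      ∃ D : ℝ → ℝ, ContinuousOn D (Set.Icc 0 1) ∧
        ∀ ε : ℝ, 0 ≤ ε → ε ≤ 1 →
        ∀ μ : ℝ → ℝ →
            MeasureTheory.Measure (Literature.MathematicalPhysics.KineticTheory.HeatConduction.PhaseSpace N),
          (∀ T_L T_R : ℝ, 0 < T_L → 0 < T_R →
            (Literature.MathematicalPhysics.KineticTheory.HeatConduction.pinnedChain ω₂ lam β γ).IsFlipSteadyState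
                N T_L T_R ε (μ T_L T_R) ∧
              ∀ ν : MeasureTheory.Measure (Literature.MathematicalPhysics.KineticTheory.HeatConduction.PhaseSpace N),
                (Literature.MathematicalPhysics.KineticTheory.HeatConduction.pinnedChain ω₂ lam β γ).IsFlipSteadyState
                  N T_L T_R ε ν → ν = μ T_L T_R) →
          Filter.Tendsto (fun δ : ℝ =>
              (Literature.MathematicalPhysics.KineticTheory.HeatConduction.pinnedChain ω₂ lam β γ).totalCurrent
                (μ (T + δ / 2) (T - δ / 2)) / δ) (nhdsWithin 0 {(0 : ℝ)}ᶜ) (nhds (D ε)) := by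
  sorry

/-- **Stub 3 — `stub_positiveNoisyConductance` (fixed-`N` positivity of the noisy conductance; size M).**
For all parameters `> 0`, `N ≥ 2`, `ε ∈ [0,1]`, `T > 0`, every unique flip-steady family at rate `ε` and its
response coefficient `D` at `T`: `0 < D`.  At `ε = 0` this is stmt-11750 `PositiveConductance` at one `N`
(finite-volume Kubo formula `D_N = lim_t Var(Q_t)/(2tT²) ≥ 0` is NON-degenerate: the time-integrated boundary
energy current is not an `L²`-coboundary; Rey-Bellet 2003 Rem 4.4 (56), Kundu–Dhar–Narayan 2009); the flips
add the symmetric Dirichlet form `ε‖·‖²_P ≥ 0` and change nothing in the argument.  Needed so that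
`R_N = (N−1)/D_N` is a resistance and `ε ↦ 1/D_N(ε)` is continuous on `[0,1]`. -/
theorem Holds.stub_positiveNoisyConductance :
    ∀ ω₂ lam β γ : ℝ, 0 < ω₂ → 0 < lam → 0 < β → 0 < γ →
    ∀ (N : ℕ), 2 ≤ N → ∀ ε : ℝ, 0 ≤ ε → ε ≤ 1 → ∀ T : ℝ, 0 < T →
    ∀ μ : ℝ → ℝ →
        MeasureTheory.Measure (Literature.MathematicalPhysics.KineticTheory.HeatConduction.PhaseSpace N),
      (∀ T_L T_R : ℝ, 0 < T_L → 0 < T_R →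
        (Literature.MathematicalPhysics.KineticTheory.HeatConduction.pinnedChain ω₂ lam β γ).IsFlipSteadyState
            N T_L T_R ε (μ T_L T_R) ∧
          ∀ ν : MeasureTheory.Measure (Literature.MathematicalPhysics.KineticTheory.HeatConduction.PhaseSpace N),
            (Literature.MathematicalPhysics.KineticTheory.HeatConduction.pinnedChain ω₂ lam β γ).IsFlipSteadyState
              N T_L T_R ε ν → ν = μ T_L T_R) →
      ∀ D : ℝ, Filter.Tendsto (fun δ : ℝ =>
          (Literature.MathematicalPhysics.KineticTheory.HeatConduction.pinnedChain ω₂ lam β γ).totalCurrent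
            (μ (T + δ / 2) (T - δ / 2)) / δ) (nhdsWithin 0 {(0 : ℝ)}ᶜ) (nhds D) → 0 < D := by
  sorry

/-- **Stub 4 — `stub_seriesLawAtZero` (two-sided series law of the DETERMINISTIC chain; size XL; SHARED).**
In the shape of the sibling cruxes: under weak-NESS uniqueness, along every steady-state family of
`pinnedChain ω₂ lam β γ` (all `> 0`), `T > 0`, response coefficients `D` with `D_N > 0` (`N ≥ 2`):
`∃ C ∀ N M ≥ 2, |R_{N+M} − R_N − R_M| ≤ C`, `R_N := (N−1)/D_N`.  EXACTLY stmt-14041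
`FeketeSeriesLaw.QuasiSubadditiveResistance` (upper half) ∧ stmt-11748 `JunctionLocality.SuperadditiveResistance`
(lower half): `seriesLawAtZero_of_siblings` below is the kernel-checked reduction, so this stub closes the
moment those two rank-2 cruxes land and carries no staffing of its own.  Why it might fail: theirs (no sign
principle for reservoir insertion; finite-size corrections slower than `1/N` at low `T`).  Calibration:
harmonic corner `R_N(0) → 1/c` bounded (defect `→ −1/c`, `JunctionLocality.HarmonicCalibration`, proved). -/
theorem Holds.stub_seriesLawAtZero :
    ∀ ω₂ lam β γ : ℝ, 0 < ω₂ → 0 < lam → 0 < β → 0 < γ →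
    (∀ (N : ℕ) (T_L T_R : ℝ), 0 < T_L → 0 < T_R →
      ∀ μ ν : MeasureTheory.Measure (Literature.MathematicalPhysics.KineticTheory.HeatConduction.PhaseSpace N),
        (Literature.MathematicalPhysics.KineticTheory.HeatConduction.pinnedChain ω₂ lam β γ).IsSteadyState N T_L T_R μ →
        (Literature.MathematicalPhysics.KineticTheory.HeatConduction.pinnedChain ω₂ lam β γ).IsSteadyState N T_L T_R ν →
        μ = ν) →
    ∀ μ : (N : ℕ) → ℝ → ℝ →
        MeasureTheory.Measure (Literature.MathematicalPhysics.KineticTheory.HeatConduction.PhaseSpace N),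
    (∀ (N : ℕ) (T_L T_R : ℝ), 0 < T_L → 0 < T_R →
      (Literature.MathematicalPhysics.KineticTheory.HeatConduction.pinnedChain ω₂ lam β γ).IsSteadyState N T_L T_R
        (μ N T_L T_R)) →
    ∀ T : ℝ, 0 < T → ∀ D : ℕ → ℝ,
    (∀ N : ℕ, Filter.Tendsto (fun δ : ℝ =>
        (Literature.MathematicalPhysics.KineticTheory.HeatConduction.pinnedChain ω₂ lam β γ).totalCurrent
          (μ N (T + δ / 2) (T - δ / 2)) / δ) (nhdsWithin 0 {(0 : ℝ)}ᶜ) (nhds (D N))) →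
    (∀ N : ℕ, 2 ≤ N → 0 < D N) →
    ∃ C : ℝ, ∀ N M : ℕ, 2 ≤ N → 2 ≤ M →
      |((N : ℝ) + (M : ℝ) - 1) / D (N + M) - ((N : ℝ) - 1) / D N - ((M : ℝ) - 1) / D M| ≤ C := by
  sorry

/-- **Stub 5 — `stub_uniformSeriesLawPositiveNoise` (junction constant UNIFORM in the noise; size XL;
HARDEST; the line's only new load).**  For all parameters `> 0` and `T > 0` there is ONE `C = C(ω₂,lam,β,γ,T)`
such that for EVERY flip rate `ε ∈ (0,1]`, along the unique rate-`ε` flip-steady family (all lengths) with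
response coefficients `D_N(ε)`, positive for `N ≥ 2`: `|R_{N+M}(ε) − R_N(ε) − R_M(ε)| ≤ C` for all
`N, M ≥ 2`, `R_N(ε) := (N−1)/D_N(ε)`.  Each instance is a fixed-`ε` inequality among THREE FINITE chains
(cut the `(N+M)`-chain at one bond, re-thermalise both new ends at the self-consistent temperature, bound the
insertion cost by a contact constant); flips are sitewise, energy-conserving and carry no current, so they
enter only through the junction region.  Calibration (harmonic + flips, exact): unpinned
`R_N(λ) = R_N(0) + 4λN` (Landi–de Oliveira 2013 arXiv:1305.0806 (23)–(24)) — defect `λ`-INDEPENDENT; pinned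
`R_N(λ) = λN/c′ + O(1)` (Bernardin–Kannan–Lebowitz–Lukkarinen 2012 arXiv:1110.5432 Prop 1; kit j005937).
Why it might fail (triage r1-2/3): every noise-based constant (entropy production, two-block) degenerates like
`1/ε`, so the uniformity down to `0⁺` is an `N`-uniform statement about the deterministic junction in
disguise; with stub 4 it yields `1/D_N(0)` convergent WITH rate `1/N` — strictly more than X1 outputs. -/
theorem Holds.stub_uniformSeriesLawPositiveNoise :
    ∀ ω₂ lam β γ : ℝ, 0 < ω₂ → 0 < lam → 0 < β → 0 < γ → ∀ T : ℝ, 0 < T →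
    ∃ C : ℝ, ∀ ε : ℝ, 0 < ε → ε ≤ 1 →
    ∀ μ : (N : ℕ) → ℝ → ℝ →
        MeasureTheory.Measure (Literature.MathematicalPhysics.KineticTheory.HeatConduction.PhaseSpace N),
    (∀ (N : ℕ) (T_L T_R : ℝ), 0 < T_L → 0 < T_R →
      (Literature.MathematicalPhysics.KineticTheory.HeatConduction.pinnedChain ω₂ lam β γ).IsFlipSteadyState
          N T_L T_R ε (μ N T_L T_R) ∧
        ∀ ν : MeasureTheory.Measure (Literature.MathematicalPhysics.KineticTheory.HeatConduction.PhaseSpace N),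
          (Literature.MathematicalPhysics.KineticTheory.HeatConduction.pinnedChain ω₂ lam β γ).IsFlipSteadyState
            N T_L T_R ε ν → ν = μ N T_L T_R) →
    ∀ D : ℕ → ℝ,
    (∀ N : ℕ, Filter.Tendsto (fun δ : ℝ =>
        (Literature.MathematicalPhysics.KineticTheory.HeatConduction.pinnedChain ω₂ lam β γ).totalCurrent
          (μ N (T + δ / 2) (T - δ / 2)) / δ) (nhdsWithin 0 {(0 : ℝ)}ᶜ) (nhds (D N))) →
    (∀ N : ℕ, 2 ≤ N → 0 < D N) →
    ∀ N M : ℕ, 2 ≤ N → 2 ≤ M →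
      |((N : ℝ) + (M : ℝ) - 1) / D (N + M) - ((N : ℝ) - 1) / D N - ((M : ℝ) - 1) / D M| ≤ C := by
  sorry

/-- **Stub 6 — `stub_equicontinuityOfSeriesLaw` (the transfer; pure real analysis; size M; provable now).**
If `r N : ℝ → ℝ` is continuous on `[0,1]` for every `N ≥ 2` and the two-sided series law
`|(N+M−1)·r_{N+M}(ε) − (N−1)·r_N(ε) − (M−1)·r_M(ε)| ≤ C` holds for all `ε ∈ [0,1]`, `N, M ≥ 2` with ONE
`C`, then there is `w → 0` at `0⁺` with `|r_N(ε) − r_N(0)| ≤ w(ε)` for all `N ≥ 2`, `ε ∈ (0,1]`.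
Proof (card; re-derived by all three triagers; the two-sidedness makes Fekete unnecessary): put
`R_N := (N−1) r_N`.  Induction on `k` gives `|R_{kn} − k R_n| ≤ (k−1)C` (`n ≥ 2`, `k ≥ 1`), so
`|R_{kn}/(kn) − R_n/n| ≤ C/n`; comparing `R_n/n` and `R_m/m` with `R_{nm}/(nm)` gives
`|R_n/n − R_m/m| ≤ C/n + C/m`: the sequence `R_n(ε)/n` is Cauchy UNIFORMLY in `ε`, with limit `ℓ(ε)` and
`|R_n(ε) − nℓ(ε)| ≤ C` for every `n ≥ 2` (let `k → ∞` in the first bound).  `|ℓ| ≤ (sup_[0,1]|r_2| + C)/2`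
(`n = 2`: `R_2 = r_2`, continuous on the compact interval), hence `|r_N − ℓ| ≤ (C + |ℓ|_∞)/(N−1)`: uniform
convergence on `[0,1]`, so `ℓ` is continuous (`TendstoUniformlyOn.continuousOn`);
`w(ε) := sup_{N ≥ 2} |r_N(ε) − r_N(0)|` is finite (`≤ 2(C + |ℓ|_∞) + 2|ℓ|_∞`) and `→ 0` at `0⁺` by the
split `N ≥ N₀` (`2(C+|ℓ|_∞)/(N₀−1) + |ℓ(ε) − ℓ(0)|`) / `N < N₀` (finitely many functions continuous at `0`
within `[0,1]`).  (Fekete form, equivalent: `R_N + C` subadditive and `R_N − C` superadditive on `{N ≥ 2}`.)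
If `C < 0` the hypothesis is contradictory at any instance and the statement is trivial.
Mathlib: `Metric.uniformCauchySeqOn_iff`, `UniformCauchySeqOn.tendstoUniformlyOn_of_tendsto`,
`TendstoUniformlyOn.continuousOn`, `Metric.continuousWithinAt_iff`, `ciSup_le`. -/
theorem Holds.stub_equicontinuityOfSeriesLaw :
    ∀ (r : ℕ → ℝ → ℝ) (C : ℝ),
      (∀ N : ℕ, 2 ≤ N → ContinuousOn (r N) (Set.Icc 0 1)) →
      (∀ ε ∈ Set.Icc (0 : ℝ) 1, ∀ N M : ℕ, 2 ≤ N → 2 ≤ M →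
        |((N : ℝ) + (M : ℝ) - 1) * r (N + M) ε - ((N : ℝ) - 1) * r N ε - ((M : ℝ) - 1) * r M ε| ≤ C) →
      ∃ w : ℝ → ℝ, Filter.Tendsto w (nhdsWithin 0 (Set.Ioi 0)) (nhds 0) ∧
        ∀ N : ℕ, 2 ≤ N → ∀ ε : ℝ, 0 < ε → ε ≤ 1 → |r N ε - r N 0| ≤ w ε := by
  sorry

/-! ### By-name handles of the six statements (no second copy of the text) -/

/-- Statement of registered stub 1 (`Holds.stub_flipSteadyStateWellPosed`), by name. -/
def stub_flipSteadyStateWellPosed : Prop := type_of% Holds.stub_flipSteadyStateWellPosed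
/-- Statement of registered stub 2 (`Holds.stub_responseContinuousInNoise`), by name. -/
def stub_responseContinuousInNoise : Prop := type_of% Holds.stub_responseContinuousInNoise
/-- Statement of registered stub 3 (`Holds.stub_positiveNoisyConductance`), by name. -/
def stub_positiveNoisyConductance : Prop := type_of% Holds.stub_positiveNoisyConductance
/-- Statement of registered stub 4 (`Holds.stub_seriesLawAtZero`), by name. -/
def stub_seriesLawAtZero : Prop := type_of% Holds.stub_seriesLawAtZero
/-- Statement of registered stub 5 (`Holds.stub_uniformSeriesLawPositiveNoise`), by name. -/
def stub_uniformSeriesLawPositiveNoise : Prop := type_of% Holds.stub_uniformSeriesLawPositiveNoise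
/-- Statement of registered stub 6 (`Holds.stub_equicontinuityOfSeriesLaw`), by name. -/
def stub_equicontinuityOfSeriesLaw : Prop := type_of% Holds.stub_equicontinuityOfSeriesLaw

/-! ## Dependency edges to existing items (proved): stubs 1 and 4 are shared content, not new load -/

/-- **Stub 1 ⇐ X3 (i) ∧ NessUnique.**  Clause (i) of the route's own `NoisyFourier` (every `ε > 0`) and the
shared support `NessUnique` (stmt-0741) with the landed existence theorem
`pinnedChain_exists_isSteadyState` (`ε = 0`, `isFlipSteadyState_zero_iff`) give stub 1. [folklore] -/
theorem wellPosed_of_noisyFourier_nessUnique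
    (hNF : Summit.AtomisticToContinuum.FouriersLaw.Theses.VanishingNoiseTransfer.NoisyFourier)
    (hNU : Summit.AtomisticToContinuum.FouriersLaw.Theses.VanishingNoiseTransfer.NessUnique) :
    stub_flipSteadyStateWellPosed := by
  intro ω₂ lam β γ hω hl hβ hγ N ε hε0 _hε1 T_L T_R hL hR
  rcases hε0.lt_or_eq with hε | hε
  · -- positive rate: NoisyFourier clause (i)
    obtain ⟨hexu, -⟩ := hNF ω₂ lam β γ hω hl hβ hγ _ rfl ε hε
    exact hexu N T_L T_R hL hR
  · -- rate 0: the deterministic chain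
    subst hε
    obtain ⟨μ, hμ⟩ := pinnedChain_exists_isSteadyState hω hl hβ hγ N hL hR
    refine ⟨μ, ((pinnedChain ω₂ lam β γ).isFlipSteadyState_zero_iff N T_L T_R μ).2 hμ, fun ν hν => ?_⟩
    exact hNU ω₂ lam β γ hω hl hβ hγ N T_L T_R hL hR ν μ
      (((pinnedChain ω₂ lam β γ).isFlipSteadyState_zero_iff N T_L T_R ν).1 hν) hμ

/-- **Stub 4 = stmt-14041 ∧ stmt-11748.**  The upper half of the series law at `ε = 0` is
`FeketeSeriesLaw.QuasiSubadditiveResistance`, the lower half `JunctionLocality.SuperadditiveResistance`;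
together (constant `max C₁ C₂`, casts `((N - 1 : ℕ) : ℝ) = N - 1` for `N ≥ 2`) they give stub 4. [folklore] -/
theorem seriesLawAtZero_of_siblings
    (hsub : Summit.AtomisticToContinuum.FouriersLaw.Theses.FeketeSeriesLaw.QuasiSubadditiveResistance)
    (hsup : Summit.AtomisticToContinuum.FouriersLaw.Theses.JunctionLocality.SuperadditiveResistance) :
    stub_seriesLawAtZero := by
  intro ω₂ lam β γ hω hl hβ hγ huniq μ hμ T hT D hD hpos
  obtain ⟨C₁, h₁⟩ := hsub ω₂ lam β γ hω hl hβ hγ huniq μ hμ T hT D hD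
  obtain ⟨C₂, h₂⟩ := hsup ω₂ lam β γ hω hl hβ hγ huniq μ hμ T hT D hD hpos
  refine ⟨max C₁ C₂, fun N M hN hM => ?_⟩
  have e1 : ((N - 1 : ℕ) : ℝ) = (N : ℝ) - 1 := by
    rw [Nat.cast_sub (by omega : 1 ≤ N), Nat.cast_one]
  have e2 : ((M - 1 : ℕ) : ℝ) = (M : ℝ) - 1 := by
    rw [Nat.cast_sub (by omega : 1 ≤ M), Nat.cast_one]
  have e3 : ((N + M - 1 : ℕ) : ℝ) = (N : ℝ) + (M : ℝ) - 1 := by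
    rw [Nat.cast_sub (by omega : 1 ≤ N + M), Nat.cast_add, Nat.cast_one]
  have hup := h₁ N M hN hM
  rw [e1, e2, e3] at hup
  have hlo := h₂ N M hN hM
  have hm1 := le_max_left C₁ C₂
  have hm2 := le_max_right C₁ C₂
  rw [abs_le]
  constructor <;> linarith

/-! ## Stub 2 is load-bearing (triage r1-2's mutation, kernel-checked)

Without continuity of `r N` at `ε = 0` the transfer (stub 6) fails: `r_N(ε) := 1` at `ε = 0`, `0` on
`(0,1]` obeys the two-sided series law with `C = 1`, yet `|r_N(ε) − r_N(0)| = 1` for every `ε > 0`. -/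

/-- The series law alone (no continuity in the noise at fixed `N`) does not give a modulus. [folklore] -/
theorem seriesLaw_without_continuity_insufficient :
    ∃ (r : ℕ → ℝ → ℝ) (C : ℝ),
      (∀ ε ∈ Set.Icc (0 : ℝ) 1, ∀ N M : ℕ, 2 ≤ N → 2 ≤ M →
        |((N : ℝ) + (M : ℝ) - 1) * r (N + M) ε - ((N : ℝ) - 1) * r N ε - ((M : ℝ) - 1) * r M ε| ≤ C) ∧
      ¬ ∃ w : ℝ → ℝ, Filter.Tendsto w (nhdsWithin 0 (Set.Ioi 0)) (nhds 0) ∧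
          ∀ N : ℕ, 2 ≤ N → ∀ ε : ℝ, 0 < ε → ε ≤ 1 → |r N ε - r N 0| ≤ w ε := by
  refine ⟨fun _ ε => if ε = 0 then 1 else 0, 1, ?_, ?_⟩
  · intro ε _ N M _ _
    by_cases h : ε = 0
    · subst h
      have e : ((N : ℝ) + (M : ℝ) - 1) * 1 - ((N : ℝ) - 1) * 1 - ((M : ℝ) - 1) * 1 = 1 := by ring
      simp only [if_true, e, abs_one, le_refl]
    · simp [h]
  · rintro ⟨w, hw, hb⟩
    have h1 : ∀ᶠ ε in nhdsWithin (0 : ℝ) (Set.Ioi 0), w ε < 1 := by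
      filter_upwards [(Metric.tendsto_nhds.mp hw) 1 one_pos] with ε hε
      rw [Real.dist_eq, sub_zero] at hε
      exact (le_abs_self _).trans_lt hε
    have h2 : ∀ᶠ ε in nhdsWithin (0 : ℝ) (Set.Ioi 0), ε ≤ 1 :=
      mem_nhdsWithin_of_mem_nhds (Iic_mem_nhds one_pos)
    have h3 : ∀ᶠ ε in nhdsWithin (0 : ℝ) (Set.Ioi 0), 0 < ε := self_mem_nhdsWithin
    obtain ⟨ε, hε1, hε2, hε3⟩ := (h1.and (h2.and h3)).exists
    have hε0 : ε ≠ 0 := hε3.ne'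
    have := hb 2 le_rfl ε hε3 hε2
    simp only [hε0, if_false, if_true, zero_sub, abs_neg, abs_one] at this
    linarith

/-! ## Small lemmas for the composition (proved) -/

/-- A chain with at most one site carries no current: every bond sum is empty. [folklore] -/
theorem totalCurrent_eq_zero_of_le_one (P : OscillatorChain) {N : ℕ} (hN : N ≤ 1)
    (μ : Measure (PhaseSpace N)) : P.totalCurrent μ = 0 := by
  unfold OscillatorChain.totalCurrent
  refine Finset.sum_eq_zero fun i _ => ?_
  have hb : ∀ x, P.bondCurrent N i x = 0 := by
    intro x
    unfold OscillatorChain.bondCurrent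
    refine Finset.sum_eq_zero fun j _ => ?_
    have hj : j.val ≠ i.val + 1 := by
      have := j.isLt
      omega
    simp [hj]
  simp [hb]

/-- Along `𝓝[≠] 0` the response quotient of a currentless chain tends only to `0`. [folklore] -/
theorem response_eq_zero_of_le_one (P : OscillatorChain) {N : ℕ} (hN : N ≤ 1)
    (μ : ℝ → ℝ → Measure (PhaseSpace N)) (T D : ℝ)
    (hD : Tendsto (fun δ : ℝ => P.totalCurrent (μ (T + δ / 2) (T - δ / 2)) / δ) (𝓝[≠] 0) (𝓝 D)) :
    D = 0 := by
  have h0 : Tendsto (fun δ : ℝ => P.totalCurrent (μ (T + δ / 2) (T - δ / 2)) / δ) (𝓝[≠] 0) (𝓝 0) := by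
    simp only [totalCurrent_eq_zero_of_le_one P hN, zero_div]
    exact tendsto_const_nhds
  exact tendsto_nhds_unique hD h0

/-! ## Composition (sorry-free): the six stubs give the crux BY NAME -/

/-- **`NoiseLocality_of`** — stubs 1–6 ⟹ `VanishingNoiseTransfer.NoiseLocality` (kernel-checked).
Canonical flip-steady family by choice (stub 1); canonical responses `Dc N : ℝ → ℝ`, continuous on `[0,1]`
(stub 2), positive for `N ≥ 2` (stub 3); series-law constants `C₀` at `ε = 0` (stub 4, through
`isFlipSteadyState_zero_iff`) and `C₁` on `(0,1]` (stub 5); the transfer (stub 6) at `r N ε := (Dc N ε)⁻¹`,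
`C := max C₀ C₁` yields `w`; finally the crux's own `μ0, με, D0, Dε` are identified with the canonical ones by
uniqueness of limits along `𝓝[≠] 0` (`N ≥ 2`), and `N ≤ 1` is currentless. [folklore] -/
theorem NoiseLocality_of (h1 : stub_flipSteadyStateWellPosed) (h2 : stub_responseContinuousInNoise)
    (h3 : stub_positiveNoisyConductance) (h4 : stub_seriesLawAtZero)
    (h5 : stub_uniformSeriesLawPositiveNoise) (h6 : stub_equicontinuityOfSeriesLaw) :
    Summit.AtomisticToContinuum.FouriersLaw.Theses.VanishingNoiseTransfer.NoiseLocality := by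
  intro ω₂ lam β γ hω hl hβ hγ S hS T hT
  subst hS
  -- (0) the canonical flip-steady family `μc N ε T_L T_R` (stub 1 + choice; junk outside the box)
  have hex : ∀ (N : ℕ) (ε T_L T_R : ℝ), ∃ μ : Measure (PhaseSpace N),
      (0 ≤ ε → ε ≤ 1 → 0 < T_L → 0 < T_R →
        (pinnedChain ω₂ lam β γ).IsFlipSteadyState N T_L T_R ε μ ∧
          ∀ ν : Measure (PhaseSpace N),
            (pinnedChain ω₂ lam β γ).IsFlipSteadyState N T_L T_R ε ν → ν = μ) := by
    intro N ε T_L T_R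
    by_cases h : 0 ≤ ε ∧ ε ≤ 1 ∧ 0 < T_L ∧ 0 < T_R
    · obtain ⟨μ, hμ⟩ := h1 ω₂ lam β γ hω hl hβ hγ N ε h.1 h.2.1 T_L T_R h.2.2.1 h.2.2.2
      exact ⟨μ, fun _ _ _ _ => hμ⟩
    · exact ⟨0, fun h0 h1' hL hR => (h ⟨h0, h1', hL, hR⟩).elim⟩
  choose μc hμc using hex
  have hfam : ∀ (N : ℕ) (ε : ℝ), 0 ≤ ε → ε ≤ 1 → ∀ T_L T_R : ℝ, 0 < T_L → 0 < T_R →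
      (pinnedChain ω₂ lam β γ).IsFlipSteadyState N T_L T_R ε (μc N ε T_L T_R) ∧
        ∀ ν : Measure (PhaseSpace N),
          (pinnedChain ω₂ lam β γ).IsFlipSteadyState N T_L T_R ε ν → ν = μc N ε T_L T_R :=
    fun N ε h0 h1' T_L T_R hL hR => hμc N ε T_L T_R h0 h1' hL hR
  -- (1) canonical responses `Dc N : ℝ → ℝ`, continuous on `[0,1]` (stub 2)
  choose Dc hDc_cont hDc using fun N : ℕ => h2 ω₂ lam β γ hω hl hβ hγ N T hT
  have hDc_can : ∀ (N : ℕ) (ε : ℝ), 0 ≤ ε → ε ≤ 1 →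
      Tendsto (fun δ : ℝ => (pinnedChain ω₂ lam β γ).totalCurrent
        (μc N ε (T + δ / 2) (T - δ / 2)) / δ) (𝓝[≠] 0) (𝓝 (Dc N ε)) :=
    fun N ε h0 h1' => hDc N ε h0 h1' (μc N ε) (hfam N ε h0 h1')
  -- (2) positivity of the canonical responses for `N ≥ 2` (stub 3)
  have hpos : ∀ N : ℕ, 2 ≤ N → ∀ ε : ℝ, 0 ≤ ε → ε ≤ 1 → 0 < Dc N ε :=
    fun N hN ε h0 h1' => h3 ω₂ lam β γ hω hl hβ hγ N hN ε h0 h1' T hT (μc N ε) (hfam N ε h0 h1')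
      (Dc N ε) (hDc_can N ε h0 h1')
  -- (3) series law at `ε = 0` (stub 4, deterministic vocabulary via `isFlipSteadyState_zero_iff`)
  have huniq0 : ∀ (N : ℕ) (T_L T_R : ℝ), 0 < T_L → 0 < T_R →
      ∀ μ ν : Measure (PhaseSpace N),
        (pinnedChain ω₂ lam β γ).IsSteadyState N T_L T_R μ →
        (pinnedChain ω₂ lam β γ).IsSteadyState N T_L T_R ν → μ = ν := by
    intro N T_L T_R hL hR μ ν hμ hν
    have hu := (hfam N 0 le_rfl zero_le_one T_L T_R hL hR).2
    rw [hu μ (((pinnedChain ω₂ lam β γ).isFlipSteadyState_zero_iff N T_L T_R μ).2 hμ),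
      hu ν (((pinnedChain ω₂ lam β γ).isFlipSteadyState_zero_iff N T_L T_R ν).2 hν)]
  have hst0 : ∀ (N : ℕ) (T_L T_R : ℝ), 0 < T_L → 0 < T_R →
      (pinnedChain ω₂ lam β γ).IsSteadyState N T_L T_R (μc N 0 T_L T_R) :=
    fun N T_L T_R hL hR =>
      ((pinnedChain ω₂ lam β γ).isFlipSteadyState_zero_iff N T_L T_R _).1
        (hfam N 0 le_rfl zero_le_one T_L T_R hL hR).1
  obtain ⟨C₀, hC₀⟩ := h4 ω₂ lam β γ hω hl hβ hγ huniq0 (fun N T_L T_R => μc N 0 T_L T_R) hst0 T hT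
    (fun N => Dc N 0) (fun N => hDc_can N 0 le_rfl zero_le_one)
    (fun N hN => hpos N hN 0 le_rfl zero_le_one)
  -- (4) series law on `(0,1]`, one constant (stub 5)
  obtain ⟨C₁, hC₁⟩ := h5 ω₂ lam β γ hω hl hβ hγ T hT
  have hC₁' : ∀ ε : ℝ, 0 < ε → ε ≤ 1 → ∀ N M : ℕ, 2 ≤ N → 2 ≤ M →
      |((N : ℝ) + (M : ℝ) - 1) / Dc (N + M) ε - ((N : ℝ) - 1) / Dc N ε - ((M : ℝ) - 1) / Dc M ε| ≤ C₁ :=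
    fun ε hε hε1 => hC₁ ε hε hε1 (fun N T_L T_R => μc N ε T_L T_R)
      (fun N T_L T_R hL hR => hfam N ε hε.le hε1 T_L T_R hL hR) (fun N => Dc N ε)
      (fun N => hDc_can N ε hε.le hε1) (fun N hN => hpos N hN ε hε.le hε1)
  -- (5) the transfer (stub 6) at `r N ε := (Dc N ε)⁻¹`, `C := max C₀ C₁`
  have hcont : ∀ N : ℕ, 2 ≤ N → ContinuousOn (fun ε : ℝ => (Dc N ε)⁻¹) (Set.Icc 0 1) :=
    fun N hN => (hDc_cont N).inv₀ fun ε hε => (hpos N hN ε hε.1 hε.2).ne'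
  have hlaw : ∀ ε ∈ Set.Icc (0 : ℝ) 1, ∀ N M : ℕ, 2 ≤ N → 2 ≤ M →
      |((N : ℝ) + (M : ℝ) - 1) * (Dc (N + M) ε)⁻¹ - ((N : ℝ) - 1) * (Dc N ε)⁻¹ -
          ((M : ℝ) - 1) * (Dc M ε)⁻¹| ≤ max C₀ C₁ := by
    intro ε hε N M hN hM
    simp only [← div_eq_mul_inv]
    rcases hε.1.lt_or_eq with hε0 | hε0
    · exact (hC₁' ε hε0 hε.2 N M hN hM).trans (le_max_right _ _)
    · subst hε0
      exact (hC₀ N M hN hM).trans (le_max_left _ _)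
  obtain ⟨w, hw, hwb⟩ := h6 (fun N ε => (Dc N ε)⁻¹) (max C₀ C₁) hcont hlaw
  -- (6) the crux for its own `μ0, με, D0, Dε`
  refine ⟨w, hw, ?_⟩
  intro N ε hε hε1 μ0 με hμ0 hμε D0 Dε hD0 hDε
  by_cases hN : 2 ≤ N
  · -- `μ0` is a unique flip-steady family at rate 0, `με` at rate `ε`: identify the responses
    have hμ0' : ∀ T_L T_R : ℝ, 0 < T_L → 0 < T_R →
        (pinnedChain ω₂ lam β γ).IsFlipSteadyState N T_L T_R 0 (μ0 T_L T_R) ∧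
          ∀ ν : Measure (PhaseSpace N),
            (pinnedChain ω₂ lam β γ).IsFlipSteadyState N T_L T_R 0 ν → ν = μ0 T_L T_R := by
      intro T_L T_R hL hR
      refine ⟨((pinnedChain ω₂ lam β γ).isFlipSteadyState_zero_iff N T_L T_R _).2 (hμ0 T_L T_R hL hR).1,
        fun ν hν => (hμ0 T_L T_R hL hR).2 ν ?_⟩
      exact ((pinnedChain ω₂ lam β γ).isFlipSteadyState_zero_iff N T_L T_R ν).1 hν
    have hμε' : ∀ T_L T_R : ℝ, 0 < T_L → 0 < T_R →
        (pinnedChain ω₂ lam β γ).IsFlipSteadyState N T_L T_R ε (με T_L T_R) ∧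
          ∀ ν : Measure (PhaseSpace N),
            (pinnedChain ω₂ lam β γ).IsFlipSteadyState N T_L T_R ε ν → ν = με T_L T_R :=
      hμε
    have hD0eq : D0 = Dc N 0 := tendsto_nhds_unique hD0 (hDc N 0 le_rfl zero_le_one μ0 hμ0')
    have hDεeq : Dε = Dc N ε := tendsto_nhds_unique hDε (hDc N ε hε.le hε1 με hμε')
    have hD0pos : 0 < D0 := hD0eq ▸ hpos N hN 0 le_rfl zero_le_one
    have hDεpos : 0 < Dε := hDεeq ▸ hpos N hN ε hε.le hε1
    have hb : |Dε⁻¹ - D0⁻¹| ≤ w ε := by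
      rw [hD0eq, hDεeq]
      exact hwb N hN ε hε hε1
    have key : D0 - Dε = D0 * Dε * (Dε⁻¹ - D0⁻¹) := by
      rw [mul_sub, mul_assoc, mul_inv_cancel₀ hDεpos.ne', mul_one, mul_comm D0 Dε, mul_assoc,
        mul_inv_cancel₀ hD0pos.ne', mul_one]
    rw [key, abs_mul, abs_mul]
    calc |D0| * |Dε| * |Dε⁻¹ - D0⁻¹| ≤ |D0| * |Dε| * w ε := by gcongr
      _ = w ε * |D0| * |Dε| := by ring
  · -- `N ≤ 1`: no bond, no current, `D0 = Dε = 0`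
    have hN1 : N ≤ 1 := by omega
    have h0 : D0 = 0 := response_eq_zero_of_le_one _ hN1 μ0 T D0 hD0
    have hε0 : Dε = 0 := response_eq_zero_of_le_one _ hN1 με T Dε hDε
    simp [h0, hε0]

/-- D-0027 §3.3 shape: the crux from the registered stubs (an `example`, so that `NoiseLocality_of`
stays the unique theorem concluding the crux; it becomes a proof once the six `sorry`s are discharged). -/
example : Summit.AtomisticToContinuum.FouriersLaw.Theses.VanishingNoiseTransfer.NoiseLocality :=
  NoiseLocality_of Holds.stub_flipSteadyStateWellPosed Holds.stub_responseContinuousInNoise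
    Holds.stub_positiveNoisyConductance Holds.stub_seriesLawAtZero
    Holds.stub_uniformSeriesLawPositiveNoise Holds.stub_equicontinuityOfSeriesLaw

end Summit.AtomisticToContinuum.FouriersLaw.Cruxes.NoiseLocality.FeketeTransposedUniformity

end
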